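import Mathlib.Analysis.Distribution.SchwartzSpace.Fourier
import Mathlib.Analysis.SpecialFunctions.SmoothTransition
import Mathlib.MeasureTheory.Measure.Haar.NormedSpace
import Literature.Analysis.FluidPDE.VectorCalculus
import HarnessLib

/-!
# C162 `Dodge2026` — refuter kit, FIELD TOOLKIT (ns-claims-refuter-1 g4)

A band-limited, divergence-free Schwartz velocity field on `ℝ³` with non-zero vorticity — the countermodel to
Lemma 3 of Dodge, *Global Regularity of 3D Incompressible Navier–Stokes via Scale-Dependent Geometric
Decoherence* (Zenodo 21515457), p.4 l.26–29 («Let u be a divergence-free velocity field with ‖ω‖_{L∞} = M …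
supp(ω̂) ∩ {|k| ≥ (M/ν)^{1/2}} ≠ ∅»), typed as `Literature.Claims.NS.Dodge2026.Step4a_L3support`; the
refutation itself is `SoloRefuteDodge2026.lean`. Construction (all objects are Mathlib Schwartz maps, so every
Fourier identity is a theorem of `Mathlib.Analysis.Distribution.SchwartzSpace.Fourier`):
* `φr k = smoothTransition (2 − 4‖k‖²)` — a smooth radial bump, `= 1` on `‖k‖ ≤ 1/2`, `= 0` on `‖k‖² ≥ 1/2`;
  `ψ = 𝓕⁻¹ φr` (a real-valued Schwartz function: `ψ_im`), so `𝓕 ψ = 0` off the ball `‖k‖² < 1/2`;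
* `ub = (∂₁ Re ψ, −∂₀ Re ψ, 0)` (`ubS : 𝓢(ℝ³, ℝ³)`): smooth, divergence-free (`isDivFree_ub`), with vorticity
  components the real parts of second partials of `ψ` (`curl_ub`, `vortC`), hence band-limited:
  `fourier_vort_eq_zero : ‖k‖² ≥ 1/2 → 𝓕 ωᵢ (k) = 0`;
* `curl_ub_zero_two_pos : 0 < ω₂(0) = 4π² ∫ (k₀² + k₁²) φr(k) dk`, so `ω ≢ 0`; `curl_ub_bounded`.
[folklore]

WHAT THIS IS NOT: not a claim about NS regularity or blow-up; not a claim about any author beyond the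
typed locator.
-/

set_option linter.dupNamespace false

noncomputable section

open MeasureTheory SchwartzMap FourierTransform Real Set
open scoped FourierTransform RealInnerProductSpace ContDiff LineDeriv

namespace Summit.NavierStokesRegularity.NavierStokesRegularity.Theorems.Dodge2026

open Literature.Analysis.FluidPDE

/-- `ℝ³`. -/
abbrev E3 : Type := EuclideanSpace ℝ (Fin 3)


/-- radial bump in Fourier space: `φr k = smoothTransition (2 - 4‖k‖²)`, = 1 on ‖k‖² ≤ 1/4, = 0 on ‖k‖² ≥ 1/2. -/
def φr (k : E3) : ℝ := Real.smoothTransition (2 - 4 * ‖k‖ ^ 2)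

/-- `φr_contDiff` (toolkit plumbing for the band-limited field). [folklore] -/
theorem φr_contDiff : ContDiff ℝ ∞ φr := by
  unfold φr
  exact Real.smoothTransition.contDiff.comp ((contDiff_const.sub (contDiff_const.mul (contDiff_norm_sq ℝ))))

/-- `φr_nonneg` (toolkit plumbing for the band-limited field). [folklore] -/
theorem φr_nonneg (k : E3) : 0 ≤ φr k := Real.smoothTransition.nonneg _

/-- `φr_eq_zero` (toolkit plumbing for the band-limited field). [folklore] -/
theorem φr_eq_zero {k : E3} (hk : 1 / 2 ≤ ‖k‖ ^ 2) : φr k = 0 :=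
  Real.smoothTransition.zero_of_nonpos (by linarith)

/-- `φr_neg` (toolkit plumbing for the band-limited field). [folklore] -/
theorem φr_neg (k : E3) : φr (-k) = φr k := by simp [φr, norm_neg]

/-- `φr_support` (toolkit plumbing for the band-limited field). [folklore] -/
theorem φr_support : Function.support φr ⊆ Metric.closedBall (0 : E3) 1 := by
  intro k hk
  rw [Metric.mem_closedBall, dist_zero_right]
  by_contra h
  push Not at h
  apply hk
  apply φr_eq_zero
  nlinarith [norm_nonneg k]

/-- `φr_hasCompactSupport` (toolkit plumbing for the band-limited field). [folklore] -/
theorem φr_hasCompactSupport : HasCompactSupport φr :=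
  HasCompactSupport.of_support_subset_isCompact (isCompact_closedBall 0 1) φr_support

/-- complex-valued version as a Schwartz map -/
def φc : 𝓢(E3, ℂ) :=
  (φr_hasCompactSupport.comp_left (g := Complex.ofRealCLM) rfl).toSchwartzMap
    (Complex.ofRealCLM.contDiff.comp φr_contDiff)

/-- `φc_apply` (toolkit plumbing for the band-limited field). [folklore] -/
@[simp] theorem φc_apply (k : E3) : φc k = (φr k : ℂ) := rfl

/-- the band-limited Schwartz function -/
def ψ : 𝓢(E3, ℂ) := 𝓕⁻ φc

/-- `fourier_ψ` (toolkit plumbing for the band-limited field). [folklore] -/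
theorem fourier_ψ : 𝓕 ψ = φc := fourier_fourierInv_eq φc

/-- `fourier_ψ_eq_zero` (toolkit plumbing for the band-limited field). [folklore] -/
theorem fourier_ψ_eq_zero {k : E3} (hk : 1 / 2 ≤ ‖k‖ ^ 2) : 𝓕 (ψ : E3 → ℂ) k = 0 := by
  have h := congrArg (fun f : 𝓢(E3, ℂ) => f k) fourier_ψ
  change (𝓕 ψ : 𝓢(E3, ℂ)) k = φc k at h
  rw [← fourier_coe, h, φc_apply, φr_eq_zero hk, Complex.ofReal_zero]

/-- `ψ` is real-valued: conj ψ x = ψ x. -/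
theorem conj_ψ (x : E3) : starRingEnd ℂ (ψ x) = ψ x := by
  change starRingEnd ℂ (((𝓕⁻ φc : 𝓢(E3, ℂ)) : E3 → ℂ) x) = ((𝓕⁻ φc : 𝓢(E3, ℂ)) : E3 → ℂ) x
  rw [fourierInv_coe, Real.fourierInv_eq', ← integral_conj]
  rw [← integral_neg_eq_self]
  congr 1
  ext v
  simp only [φc_apply, φr_neg, smul_eq_mul, map_mul, Complex.conj_ofReal, inner_neg_left,
    ← Complex.exp_conj]
  congr 2
  rw [Complex.conj_I, mul_neg]
  push_cast
  ring

/-- `ψ_im` (toolkit plumbing for the band-limited field). [folklore] -/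
theorem ψ_im (x : E3) : (ψ x).im = 0 := by
  have h := conj_ψ x
  exact Complex.conj_eq_iff_im.1 h


/-! ### Second partial derivatives of `ψ` (as Schwartz maps) and their Fourier transforms -/

/-- standard basis vector -/
def ev (i : Fin 3) : E3 := EuclideanSpace.single i 1

/-- `pd1 b = ∂_b ψ` -/
def pd1 (b : Fin 3) : 𝓢(E3, ℂ) := ∂_{ev b} ψ

/-- `pd2 a b = ∂_a ∂_b ψ` -/
def pd2 (a b : Fin 3) : 𝓢(E3, ℂ) := ∂_{ev a} (pd1 b)

/-- `pd2_def` (toolkit plumbing for the band-limited field). [folklore] -/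
theorem pd2_def (a b : Fin 3) : pd2 a b = ∂_{ev a} (∂_{ev b} ψ) := rfl

/-- `inner_hasTemperateGrowth` (toolkit plumbing for the band-limited field). [folklore] -/
theorem inner_hasTemperateGrowth (m : E3) : (fun k : E3 => (inner ℝ k m : ℝ)).HasTemperateGrowth :=
  ((innerSL ℝ).flip m).hasTemperateGrowth

/-- `𝓕 (∂_m f) k = (2π i ⟪k, m⟫) • 𝓕 f k` -/
theorem fourier_lineDeriv_apply (f : 𝓢(E3, ℂ)) (m k : E3) :
    𝓕 (∂_{m} f) k = (2 * π * Complex.I) * ((inner ℝ k m : ℝ) • 𝓕 f k) := by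
  rw [fourier_lineDerivOp_eq]
  rw [smul_apply, smulLeftCLM_apply_apply (inner_hasTemperateGrowth m), smul_eq_mul]

/-- `fourier_pd2_apply` (toolkit plumbing for the band-limited field). [folklore] -/
theorem fourier_pd2_apply (a b : Fin 3) (k : E3) :
    𝓕 (pd2 a b) k = (2 * π * Complex.I) * ((k a : ℝ) • ((2 * π * Complex.I) * ((k b : ℝ) • (φr k : ℂ)))) := by
  rw [pd2_def, fourier_lineDeriv_apply, fourier_lineDeriv_apply, fourier_ψ, φc_apply]
  simp [ev, EuclideanSpace.inner_single_right]

/-- `fourier_pd2_eq_zero` (toolkit plumbing for the band-limited field). [folklore] -/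
theorem fourier_pd2_eq_zero (a b : Fin 3) {k : E3} (hk : 1 / 2 ≤ ‖k‖ ^ 2) :
    𝓕 (pd2 a b : E3 → ℂ) k = 0 := by
  rw [← fourier_coe, fourier_pd2_apply, φr_eq_zero hk]
  simp

/-- symmetry of mixed partials, via the Fourier side -/
theorem pd2_comm (a b : Fin 3) : pd2 a b = pd2 b a := by
  have h : 𝓕 (pd2 a b) = 𝓕 (pd2 b a) := by
    ext k
    rw [fourier_pd2_apply, fourier_pd2_apply]
    simp only [Complex.real_smul]
    ring
  have := congrArg (fun g : 𝓢(E3, ℂ) => (𝓕⁻ g : 𝓢(E3, ℂ))) h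
  simpa [fourierInv_fourier_eq] using this

/-- a Schwartz map with identically zero imaginary part has line derivatives with zero imaginary part -/
theorem im_lineDeriv_eq_zero (f : 𝓢(E3, ℂ)) (hf : ∀ x, (f x).im = 0) (m x : E3) :
    ((∂_{m} f) x).im = 0 := by
  rw [lineDerivOp_apply_eq_fderiv]
  have h1 : HasFDerivAt (fun y => (f y).im) ((Complex.imCLM).comp (fderiv ℝ f x)) x :=
    Complex.imCLM.hasFDerivAt.comp x f.differentiableAt.hasFDerivAt
  have h0 : (fun y => (f y).im) = fun _ => (0 : ℝ) := funext hf
  rw [h0] at h1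
  have h2 := h1.fderiv
  rw [fderiv_fun_const] at h2
  have h3 := congrArg (fun L : E3 →L[ℝ] ℝ => L m) h2
  simpa using h3.symm

/-- `pd1_im` (toolkit plumbing for the band-limited field). [folklore] -/
theorem pd1_im (b : Fin 3) (x : E3) : (pd1 b x).im = 0 := im_lineDeriv_eq_zero ψ ψ_im _ x

/-- `pd2_im` (toolkit plumbing for the band-limited field). [folklore] -/
theorem pd2_im (a b : Fin 3) (x : E3) : (pd2 a b x).im = 0 :=
  im_lineDeriv_eq_zero _ (pd1_im b) _ x

/-- `pd2_ofReal_re` (toolkit plumbing for the band-limited field). [folklore] -/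
theorem pd2_ofReal_re (a b : Fin 3) (x : E3) : ((pd2 a b x).re : ℂ) = pd2 a b x :=
  Complex.ext rfl (by simp [pd2_im])


/-! ### The band-limited divergence-free field `ub = (∂₁ g, -∂₀ g, 0)`, `g = Re ψ` -/


/-- `z ↦ (Re z) • e_i` as a real-linear map `ℂ →L[ℝ] E3` -/
def reVec (i : Fin 3) : ℂ →L[ℝ] E3 := (Complex.reCLM).smulRight (ev i)

/-- `reVec_apply` (toolkit plumbing for the band-limited field). [folklore] -/
@[simp] theorem reVec_apply (i : Fin 3) (z : ℂ) : reVec i z = z.re • ev i := rfl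

/-- the field as a Schwartz map -/
def ubS : 𝓢(E3, E3) :=
  postcompCLM (𝕜 := ℝ) (reVec 0) (pd1 1) - postcompCLM (𝕜 := ℝ) (reVec 1) (pd1 0)

/-- the field -/
def ub : E3 → E3 := ubS

/-- `ub_eq` (toolkit plumbing for the band-limited field). [folklore] -/
theorem ub_eq (x : E3) : ub x = (pd1 1 x).re • ev 0 - (pd1 0 x).re • ev 1 := rfl

/-- `ub_contDiff` (toolkit plumbing for the band-limited field). [folklore] -/
theorem ub_contDiff : ContDiff ℝ ∞ ub := ubS.smooth ⊤

/-- `ub_differentiable` (toolkit plumbing for the band-limited field). [folklore] -/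
theorem ub_differentiable : Differentiable ℝ ub := ubS.differentiable

/-- derivative of the field along `e_j`: `D_j ub = (Re ∂_j∂_1 ψ) e₀ − (Re ∂_j∂_0 ψ) e₁` -/
theorem fderiv_ub (x : E3) (j : Fin 3) :
    fderiv ℝ ub x (ev j) = (pd2 j 1 x).re • ev 0 - (pd2 j 0 x).re • ev 1 := by
  have h0 : HasFDerivAt (fun y => reVec 0 (pd1 1 y)) ((reVec 0).comp (fderiv ℝ (pd1 1 : E3 → ℂ) x)) x :=
    (reVec 0).hasFDerivAt.comp x (SchwartzMap.differentiableAt (pd1 1)).hasFDerivAt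
  have h1 : HasFDerivAt (fun y => reVec 1 (pd1 0 y)) ((reVec 1).comp (fderiv ℝ (pd1 0 : E3 → ℂ) x)) x :=
    (reVec 1).hasFDerivAt.comp x (SchwartzMap.differentiableAt (pd1 0)).hasFDerivAt
  have h := (h0.fun_sub h1).fderiv
  have hfun : (fun y => reVec 0 (pd1 1 y) - reVec 1 (pd1 0 y)) = ub := by
    funext y; rw [ub_eq]; rfl
  rw [hfun] at h
  rw [h]
  simp only [sub_apply, ContinuousLinearMap.comp_apply, reVec_apply]
  rfl

/-- `fderiv_ub_apply` (toolkit plumbing for the band-limited field). [folklore] -/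
theorem fderiv_ub_apply (x : E3) (j i : Fin 3) :
    fderiv ℝ ub x (ev j) i = (pd2 j 1 x).re * (ev 0 : E3) i - (pd2 j 0 x).re * (ev 1 : E3) i := by
  rw [fderiv_ub]; simp

/-- `ev_apply` (toolkit plumbing for the band-limited field). [folklore] -/
theorem ev_apply (i j : Fin 3) : (ev i : E3) j = if j = i then 1 else 0 := by
  simp [ev]

/-- `div ub = 0` -/
theorem divergence_ub (x : E3) : VectorCalculus.divergence ub x = 0 := by
  rw [divergence_eq_sum_inner_fderiv (EuclideanSpace.basisFun (Fin 3) ℝ), Fin.sum_univ_three]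
  simp only [EuclideanSpace.basisFun_apply]
  rw [show (EuclideanSpace.single 0 (1:ℝ) : E3) = ev 0 from rfl,
    show (EuclideanSpace.single 1 (1:ℝ) : E3) = ev 1 from rfl,
    show (EuclideanSpace.single 2 (1:ℝ) : E3) = ev 2 from rfl]
  simp only [ev, EuclideanSpace.inner_single_left, map_one, one_mul]
  rw [show (EuclideanSpace.single 0 (1:ℝ) : E3) = ev 0 from rfl,
    show (EuclideanSpace.single 1 (1:ℝ) : E3) = ev 1 from rfl,
    show (EuclideanSpace.single 2 (1:ℝ) : E3) = ev 2 from rfl,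
    fderiv_ub_apply, fderiv_ub_apply, fderiv_ub_apply, pd2_comm 0 1]
  simp [ev_apply]

/-- `isDivFree_ub` (toolkit plumbing for the band-limited field). [folklore] -/
theorem isDivFree_ub : VectorCalculus.IsDivFree ub := divergence_ub

/-- the vorticity, componentwise -/
theorem curl_ub (x : E3) :
    curl ub x = WithLp.toLp 2 ![(pd2 2 0 x).re, (pd2 2 1 x).re, -((pd2 0 0 x).re + (pd2 1 1 x).re)] := by
  simp only [curl]
  rw [show (EuclideanSpace.single 0 (1:ℝ) : E3) = ev 0 from rfl,
    show (EuclideanSpace.single 1 (1:ℝ) : E3) = ev 1 from rfl,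
    show (EuclideanSpace.single 2 (1:ℝ) : E3) = ev 2 from rfl]
  simp only [fderiv_ub_apply, ev_apply]
  simp
  ring_nf


/-! ### The vorticity as a Schwartz map; its Fourier support; non-vanishing -/

/-- complex Schwartz "symbols" of the three vorticity components -/
def vortC (i : Fin 3) : 𝓢(E3, ℂ) :=
  match i with
  | 0 => pd2 2 0
  | 1 => pd2 2 1
  | 2 => -(pd2 0 0 + pd2 1 1)

/-- `curl_ub_apply_re` (toolkit plumbing for the band-limited field). [folklore] -/
theorem curl_ub_apply_re (x : E3) (i : Fin 3) : curl ub x i = (vortC i x).re := by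
  rw [curl_ub]
  fin_cases i <;> simp [vortC]

/-- `vortC_im` (toolkit plumbing for the band-limited field). [folklore] -/
theorem vortC_im (i : Fin 3) (x : E3) : (vortC i x).im = 0 := by
  fin_cases i <;> simp [vortC, pd2_im]

/-- the complexified vorticity components ARE the Schwartz maps `vortC i` -/
theorem curl_ub_ofReal (x : E3) (i : Fin 3) : ((curl ub x i : ℝ) : ℂ) = vortC i x := by
  rw [curl_ub_apply_re]
  exact Complex.ext rfl (by simp [vortC_im])

/-- `curl_ub_ofReal_fun` (toolkit plumbing for the band-limited field). [folklore] -/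
theorem curl_ub_ofReal_fun (i : Fin 3) : (fun x => ((curl ub x i : ℝ) : ℂ)) = (vortC i : E3 → ℂ) :=
  funext fun x => curl_ub_ofReal x i

/-- **Band limitation of the vorticity**: `𝓕 ωᵢ (k) = 0` whenever `‖k‖² ≥ 1/2`. -/
theorem fourier_vort_eq_zero (i : Fin 3) {k : E3} (hk : 1 / 2 ≤ ‖k‖ ^ 2) :
    𝓕 (fun x => ((curl ub x i : ℝ) : ℂ)) k = 0 := by
  rw [curl_ub_ofReal_fun]
  fin_cases i
  · exact fourier_pd2_eq_zero 2 0 hk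
  · exact fourier_pd2_eq_zero 2 1 hk
  · show 𝓕 ((-(pd2 0 0 + pd2 1 1) : 𝓢(E3, ℂ)) : E3 → ℂ) k = 0
    rw [← fourier_coe]
    rw [show (𝓕 (-(pd2 0 0 + pd2 1 1)) : 𝓢(E3, ℂ)) = fourierTransformCLM ℂ (-(pd2 0 0 + pd2 1 1)) from rfl,
      map_neg, map_add, neg_apply, add_apply, fourierTransformCLM_apply, fourierTransformCLM_apply]
    rw [fourier_coe, fourier_coe, fourier_pd2_eq_zero 0 0 hk, fourier_pd2_eq_zero 1 1 hk]
    simp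

/-- value of a second partial at the origin as a Fourier-side integral -/
theorem pd2_zero_re (a : Fin 3) : (pd2 a a 0).re = ∫ v : E3, -(4 * π ^ 2 * (v a) ^ 2 * φr v) := by
  have h1 : pd2 a a = (𝓕⁻ (𝓕 (pd2 a a)) : 𝓢(E3, ℂ)) := (fourierInv_fourier_eq (pd2 a a)).symm
  have h2 : pd2 a a 0 = ∫ v : E3, 𝓕 (pd2 a a) v := by
    conv_lhs => rw [h1]
    rw [fourierInv_coe, Real.fourierInv_eq]
    simp
  rw [h2]
  have hre := integral_re (𝕜 := ℂ) (𝓕 (pd2 a a)).integrable (μ := volume)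
  simp only [RCLike.re_to_complex] at hre
  rw [← hre]
  congr 1
  funext v
  rw [fourier_pd2_apply]
  simp only [Complex.real_smul]
  have hI : Complex.I * Complex.I = -1 := Complex.I_mul_I
  have : (2 * ↑π * Complex.I * (↑(v a) * (2 * ↑π * Complex.I * (↑(v a) * ↑(φr v)))) : ℂ)
      = ((-(4 * π ^ 2 * (v a) ^ 2 * φr v) : ℝ) : ℂ) := by
    push_cast
    linear_combination (4 * (π:ℂ) ^ 2 * (v a : ℂ) ^ 2 * (φr v : ℂ)) * hI
  rw [this, Complex.ofReal_re]

/-- `integral_sq_φr_nonneg` (toolkit plumbing for the band-limited field). [folklore] -/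
theorem integral_sq_φr_nonneg (a : Fin 3) : 0 ≤ ∫ v : E3, (v a) ^ 2 * φr v :=
  integral_nonneg fun v => mul_nonneg (sq_nonneg _) (φr_nonneg v)

/-- the test frequency `(1/4) e₀` lies where `φr = 1` -/
theorem φr_quarter : φr ((1 / 4 : ℝ) • ev 0) = 1 := by
  unfold φr
  apply Real.smoothTransition.one_of_one_le
  have : ‖((1 / 4 : ℝ) • ev 0 : E3)‖ = 1 / 4 := by
    rw [norm_smul, show ‖(ev 0 : E3)‖ = 1 by simp [ev], mul_one]; norm_num
  rw [this]; norm_num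

/-- `integral_sq_φr_pos` (toolkit plumbing for the band-limited field). [folklore] -/
theorem integral_sq_φr_pos : 0 < ∫ v : E3, (v 0) ^ 2 * φr v := by
  have hcont : Continuous fun v : E3 => (v 0) ^ 2 * φr v :=
    ((continuous_apply 0 |>.comp (PiLp.continuous_ofLp 2 _)).pow 2).mul φr_contDiff.continuous
  have hsupp : HasCompactSupport fun v : E3 => (v 0) ^ 2 * φr v := φr_hasCompactSupport.mul_left
  rw [integral_pos_iff_support_of_nonneg (fun v => mul_nonneg (sq_nonneg _) (φr_nonneg v))
    (hcont.integrable_of_hasCompactSupport hsupp)]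
  refine hcont.isOpen_support.measure_pos volume ⟨(1 / 4 : ℝ) • ev 0, ?_⟩
  rw [Function.mem_support, φr_quarter]
  simp [ev]

/-- **The vorticity does not vanish**: `(curl ub 0)₂ = 4π² ∫ (v₀² + v₁²) φr > 0`. -/
theorem curl_ub_zero_two_pos : 0 < curl ub 0 2 := by
  rw [curl_ub_apply_re]
  simp only [vortC, neg_apply, add_apply, Complex.neg_re, Complex.add_re, pd2_zero_re]
  rw [integral_neg, integral_neg]
  have h0 : ∫ v : E3, 4 * π ^ 2 * (v 0) ^ 2 * φr v = 4 * π ^ 2 * ∫ v : E3, (v 0) ^ 2 * φr v := by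
    rw [← integral_const_mul]; congr 1; funext v; ring
  have h1 : ∫ v : E3, 4 * π ^ 2 * (v 1) ^ 2 * φr v = 4 * π ^ 2 * ∫ v : E3, (v 1) ^ 2 * φr v := by
    rw [← integral_const_mul]; congr 1; funext v; ring
  rw [h0, h1]
  have hA : 0 < 4 * π ^ 2 * ∫ v : E3, (v 0) ^ 2 * φr v := mul_pos (by positivity) integral_sq_φr_pos
  have hB : 0 ≤ 4 * π ^ 2 * ∫ v : E3, (v 1) ^ 2 * φr v := mul_nonneg (by positivity) (integral_sq_φr_nonneg 1)
  linarith

/-- `curl_ub_zero_ne` (toolkit plumbing for the band-limited field). [folklore] -/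
theorem curl_ub_zero_ne : curl ub 0 ≠ 0 := by
  intro h
  have := curl_ub_zero_two_pos
  rw [h] at this
  simp at this


/-- `curl_ub_bounded` (toolkit plumbing for the band-limited field). [folklore] -/
theorem curl_ub_bounded : ∃ C, ∀ x, ‖curl ub x‖ ≤ C := by
  have hb : ∀ i : Fin 3, ∃ C, ∀ x, |curl ub x i| ≤ C := by
    intro i
    refine ⟨‖(vortC i).toBoundedContinuousFunction‖, fun x => ?_⟩
    rw [curl_ub_apply_re]
    exact (Complex.abs_re_le_norm _).trans ((vortC i).toBoundedContinuousFunction.norm_coe_le_norm x)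
  choose C hC using hb
  refine ⟨Real.sqrt (∑ i, C i ^ 2), fun x => ?_⟩
  rw [EuclideanSpace.norm_eq]
  apply Real.sqrt_le_sqrt
  refine Finset.sum_le_sum fun i _ => ?_
  rw [Real.norm_eq_abs]
  have h := hC i x
  have h0 : 0 ≤ |curl ub x i| := abs_nonneg _
  nlinarith


end Summit.NavierStokesRegularity.NavierStokesRegularity.Theorems.Dodge2026
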